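import Summits.QuantumAdvantage.QuantumAdvantage.Theorems.RankDialL9
import HarnessLib

/-!
# RankDial (L10) — §43 THE NOTCH MAY GROW WITH THE BLOCK: the perturb law uniform in `η` and its GAP form `BlockGapLaw p` (a theorem, `p ≠ 3`)

TARGET BY NAME (cell decomp-qadv, RESIDUAL MODE): item stmt-QuantumAdvantage-23109
`Summit.QuantumAdvantage.QuantumAdvantage.Theses.OddPrimeWalk.ManyReadersSqrtOdd`, through rung R5 = `AdviceFreeQNC0.WalkHardFLinSel p`.
This file SUPPORTS the item (`--supports`); it does not close it.  Declaration bodies are byte-identical to §43 of the cell node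
«BlockDial» (decomp-qadv lens-1, generation 27, part L; node file RankDialL.lean, rev 8).  In §42 (`blockJSpan_holds`) the notch `η` is
fixed before the block and the budget unit `η(2η+1)·M` hides its growth; here the unit `M` depends on the width `s` and `p` only and the
notch / gap is chosen PER BLOCK.  PROVED: `GapSepBlock` (inside live cuts pairwise and from the ends at distance `≥ q`;
`sepBlock_iff_gapSepBlock`, `gapSepBlock_anti`, `sepBlock_of_gapSepBlock : GapSepBlock y a m q → SepBlock y a m (⌊m/q⌋ + 1)`);
`card_filter_le_of_fibre_le` (Fubini for fibre bounds); `exists_budget_unit`; `win_le_block_jrank_uniform` (`η` free, `M = M(s, p)`);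
★ `win_le_of_gapSepBlock` — `q`-gap-separated inside live cuts, junta rank `≤ D` at width `s`, `2M·(p·D + 2⌊ℓ/q⌋ + 4) ≤ q ≤ ℓ` ⟹
`#WIN ≤ (11/12)·2^{L+ℓ+R}` (so a gap `q ≍ max(√(M·ℓ), M·p·D)` suffices: blocks with up to `≍ √(ℓ/M)` evenly spread inside live cuts of
bounded junta rank are losing blocks); `BlockGapLaw p` + ★ `blockGapLaw_holds : p ≠ 3 → BlockGapLaw p`; `blockJSpan_of_blockGapLaw :
1 ≤ η → BlockGapLaw p → BlockJSpan p η` (the notch law back, unit `8η²·M`).  Imports part L9.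
-/

set_option linter.dupNamespace false
set_option autoImplicit false

noncomputable section
open Classical

namespace Summit.QuantumAdvantage.QuantumAdvantage.Theorems.RankDial

open Finset
open Summit.QuantumAdvantage.AdviceFreeQNC0
open Literature.Computability.MetaComplexity Literature.Computability.MetaComplexity.Smolensky

/-! ### §43 (part L «BlockDial») THE NOTCH MAY GROW WITH THE BLOCK: the perturb law uniform in `η`, and its GAP form (`q ≳ √(M·ℓ) ∨ M·p·D`) -/

section BlockGapVocab
variable {n : ℕ}

/-- **`GapSepBlock y a m q`** — the block of bit positions `[a, a+m)` is `q`-GAP-SEPARATED: every live cut strictly inside it is at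
distance `≥ q` from both ends, and any two of them are `≥ q` apart.  (`SepBlock y a m η` is the case `q = ⌊m/η⌋`,
`sepBlock_iff_gapSepBlock`; here the gap is a free parameter, so it may be chosen per block — e.g. `q ≍ √ℓ`.) -/
def GapSepBlock (y : Fin (n + 1) → (Fin n → Bool) → Bool) (a m q : ℕ) : Prop :=
  (∀ g : Fin (n + 1), a < g.val → g.val < a + m → Live y g → a + q ≤ g.val ∧ g.val + q ≤ a + m) ∧
  (∀ g h : Fin (n + 1), a < g.val → h.val < a + m → g.val < h.val → Live y g → Live y h → g.val + q ≤ h.val)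

/-- `SepBlock` is `GapSepBlock` at the gap `⌊m/η⌋` (definitional). -/
theorem sepBlock_iff_gapSepBlock (y : Fin (n + 1) → (Fin n → Bool) → Bool) (a m η : ℕ) :
    SepBlock y a m η ↔ GapSepBlock y a m (m / η) := Iff.rfl

/-- Gap separation is ANTITONE in the gap. -/
theorem gapSepBlock_anti (y : Fin (n + 1) → (Fin n → Bool) → Bool) {a m q q' : ℕ} (hle : q ≤ q') (h : GapSepBlock y a m q') :
    GapSepBlock y a m q := by
  refine ⟨fun g h1 h2 hl => ?_, fun g k h1 h2 h3 hl hk => ?_⟩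
  · have h4 := h.1 g h1 h2 hl
    omega
  · have h4 := h.2 g k h1 h2 h3 hl hk
    omega

/-- **A `q`-gap-separated block is `η`-separated at the notch `η = ⌊m/q⌋ + 1`** (`0 < q`): indeed `⌊m/(⌊m/q⌋+1)⌋ ≤ q`. -/
theorem sepBlock_of_gapSepBlock (y : Fin (n + 1) → (Fin n → Bool) → Bool) {a m q : ℕ} (hq : 0 < q) (h : GapSepBlock y a m q) :
    SepBlock y a m (m / q + 1) := by
  rw [sepBlock_iff_gapSepBlock]
  refine gapSepBlock_anti y (Nat.div_le_of_le_mul ?_) h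
  have h1 : m < m / q * q + q := Nat.lt_div_mul_add hq
  have h2 : (m / q + 1) * q = m / q * q + q := by ring
  omega

end BlockGapVocab

section BlockGapLaw
variable {p : ℕ} [Fact p.Prime] {L ℓ R : ℕ} (c : ℕ) (y : Fin (L + ℓ + R + 1) → (Fin (L + ℓ + R) → Bool) → Bool)
  (lam : Fin (L + ℓ + R + 1) → Fin (L + ℓ + R) → ZMod p) (rr : Fin (L + ℓ + R + 1) → ZMod p)

omit [Fact p.Prime] in
/-- **Fubini for fibre bounds**: if on every outside fibre `(a, b)` at most `θ·2^ℓ` contents satisfy `P`, then at most `θ·2^{L+ℓ+R}`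
inputs do (`card_filter_eq_sum_glue3`). -/
theorem card_filter_le_of_fibre_le (P : (Fin (L + ℓ + R) → Bool) → Prop) [DecidablePred P] {θ : ℝ}
    (h : ∀ (a : Fin L → Bool) (b : Fin R → Bool), ((univ.filter fun v : Fin ℓ → Bool => P (glue3 a v b)).card : ℝ) ≤ θ * 2 ^ ℓ) :
    ((univ.filter fun w : Fin (L + ℓ + R) → Bool => P w).card : ℝ) ≤ θ * (2 : ℝ) ^ (L + ℓ + R) := by
  rw [card_filter_eq_sum_glue3 P]
  push_cast
  calc ∑ a : Fin L → Bool, ∑ b : Fin R → Bool, ((univ.filter fun v : Fin ℓ → Bool => P (glue3 a v b)).card : ℝ)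
      ≤ ∑ _a : Fin L → Bool, ∑ _b : Fin R → Bool, (θ * (2 : ℝ) ^ ℓ) :=
        Finset.sum_le_sum fun a _ => Finset.sum_le_sum fun b _ => h a b
    _ = θ * (2 : ℝ) ^ (L + ℓ + R) := by
        rw [Finset.sum_const, Finset.card_univ, Fintype.card_fun, Fintype.card_bool, Fintype.card_fin, nsmul_eq_mul,
          Finset.sum_const, Finset.card_univ, Fintype.card_fun, Fintype.card_bool, Fintype.card_fin, nsmul_eq_mul]
        push_cast
        rw [pow_add, pow_add]
        ring

/-- **A budget unit exists**: for every width `s` there is `M ≥ 1` with `2·4^{s+1} ≤ M·η_p` (`η_p > 0`, part H1). -/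
theorem exists_budget_unit (p : ℕ) [Fact p.Prime] (s : ℕ) : ∃ M : ℕ, 1 ≤ M ∧ 2 * 4 ^ (s + 1) ≤ (M : ℝ) * etaP p := by
  obtain ⟨M, hM⟩ := exists_nat_ge (2 * 4 ^ (s + 1) / etaP p)
  rw [div_le_iff₀ (etaP_pos (p := p))] at hM
  refine ⟨M + 1, by omega, le_trans hM ?_⟩
  push_cast
  nlinarith [etaP_pos (p := p)]

/-- **THE PERTURB LAW, UNIFORM IN THE NOTCH** (`p ≠ 3`; the budget unit `M` depends on `s` and `p` ONLY — `2·4^{s+1} ≤ M·η_p` — and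
`η ≥ 1` is free, so it may be chosen per block): `(p·D + 2η + 2)·M ≤ ⌊ℓ/η⌋`, `1 ≤ ⌊ℓ/η⌋` ⟹ `#WIN ≤ (11/12)·2^{L+ℓ+R}`.  Fubini of
`win_fibre_le_block_jrank_absorbed`. -/
theorem win_le_block_jrank_uniform (hp3 : p ≠ 3)
    (hyl : ∀ g u, y g u = decide ((∑ i, if u i then lam g i else 0) = rr g)) {η : ℕ} (hη : 1 ≤ η)
    (hsep : SepBlock y L ℓ η) {s D M : ℕ} (hM : 2 * 4 ^ (s + 1) ≤ (M : ℝ) * etaP p) (hJR : JRankLE p y lam s D)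
    (hq : (p * D + 2 * η + 2) * M ≤ ℓ / η) (hq1 : 1 ≤ ℓ / η) :
    ((univ.filter fun u : Fin (L + ℓ + R) → Bool => ringWinU c y u = true).card : ℝ) ≤ 11 / 12 * (2 : ℝ) ^ (L + ℓ + R) :=
  card_filter_le_of_fibre_le (fun w => ringWinU c y w = true) fun a b =>
    win_fibre_le_block_jrank_absorbed c y lam rr hp3 hyl hη hsep hM hJR hq hq1 a b

/-- **THE GAP LAW OF THE BLOCK DIAL** (`p ≠ 3`, linear tests): if the live cuts strictly inside the block `[L, L+ℓ)` are `q`-gap-separated,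
the block has junta rank `≤ D` at width `s` (`JRankLE p y lam s D`), and the gap affords the budget `2M·(p·D + 2⌊ℓ/q⌋ + 4) ≤ q ≤ ℓ`
(`2·4^{s+1} ≤ M·η_p`, `M ≥ 1`) — so `q ≳ max(√(M·ℓ), M·p·D)` suffices — then `#WIN ≤ (11/12)·2^{L+ℓ+R}`.  Proof: the block is `η`-separated
at the notch `η = ⌊ℓ/q⌋ + 1` (`sepBlock_of_gapSepBlock`) and `(p·D + 2η + 2)·M·η ≤ (q/2)·(⌊ℓ/q⌋ + 1) ≤ ℓ`; then
`win_le_block_jrank_uniform`. -/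
theorem win_le_of_gapSepBlock (hp3 : p ≠ 3)
    (hyl : ∀ g u, y g u = decide ((∑ i, if u i then lam g i else 0) = rr g)) {q : ℕ} (hG : GapSepBlock y L ℓ q)
    {s D M : ℕ} (hM : 2 * 4 ^ (s + 1) ≤ (M : ℝ) * etaP p) (hM1 : 1 ≤ M) (hJR : JRankLE p y lam s D)
    (hbud : 2 * M * (p * D + 2 * (ℓ / q) + 4) ≤ q) (hqℓ : q ≤ ℓ) :
    ((univ.filter fun u : Fin (L + ℓ + R) → Bool => ringWinU c y u = true).card : ℝ) ≤ 11 / 12 * (2 : ℝ) ^ (L + ℓ + R) := by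
  have hq0 : 0 < q := lt_of_lt_of_le (Nat.mul_pos (by omega) (by omega) : 0 < 2 * M * (p * D + 2 * (ℓ / q) + 4)) hbud
  have hsep := sepBlock_of_gapSepBlock y hq0 hG
  have hη : 1 ≤ ℓ / q + 1 := Nat.le_add_left 1 (ℓ / q)
  -- the budget at the notch η = ⌊ℓ/q⌋ + 1
  have hX : 2 * ((p * D + 2 * (ℓ / q + 1) + 2) * M) ≤ q := by
    have e : 2 * ((p * D + 2 * (ℓ / q + 1) + 2) * M) = 2 * M * (p * D + 2 * (ℓ / q) + 4) := by ring
    rw [e]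
    exact hbud
  have hmul : q * (ℓ / q) ≤ ℓ := Nat.mul_div_le ℓ q
  have hq : (p * D + 2 * (ℓ / q + 1) + 2) * M ≤ ℓ / (ℓ / q + 1) := by
    rw [Nat.le_div_iff_mul_le (by omega)]
    have h1 : 2 * ((p * D + 2 * (ℓ / q + 1) + 2) * M) * (ℓ / q + 1) ≤ q * (ℓ / q + 1) := Nat.mul_le_mul_right _ hX
    have h2 : q * (ℓ / q + 1) = q * (ℓ / q) + q := by ring
    have h3 : 2 * ((p * D + 2 * (ℓ / q + 1) + 2) * M) * (ℓ / q + 1) = 2 * ((p * D + 2 * (ℓ / q + 1) + 2) * M * (ℓ / q + 1)) := by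
      ring
    omega
  have hq1 : 1 ≤ ℓ / (ℓ / q + 1) := by
    have h4 : 1 ≤ (p * D + 2 * (ℓ / q + 1) + 2) * M := le_trans hM1 (Nat.le_mul_of_pos_left M (by omega))
    exact le_trans h4 hq
  exact win_le_block_jrank_uniform c y lam rr hp3 hyl hη hsep hM hJR hq hq1

end BlockGapLaw

section BlockGapPiece
variable (p : ℕ) [Fact p.Prime]

/-- **`BlockGapLaw p`** — the gap law as one `Prop`: for every width `s` a unit `M ≥ 1` such that every linear-test strategy with a block
`[L, L+ℓ)` whose inside live cuts are `q`-gap-separated, of junta rank `≤ D` at width `s`, with `2M·(p·D + 2⌊ℓ/q⌋ + 4) ≤ q ≤ ℓ`, wins on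
`≤ (11/12)·2^{L+ℓ+R}` inputs.  [Implies `BlockJSpan p η`-type bounds with the notch chosen PER BLOCK; the gap may be as small as `≍ √(M·ℓ)`,
so blocks with up to `≍ √(ℓ/M)` evenly spread inside live cuts of bounded junta rank are losing blocks — what remains of the core
`ClusteredPiece` after §43 is: every long block has two live cuts (or a live cut and an admissible end) closer than that, OR high
junta rank.] -/
def BlockGapLaw : Prop :=
  ∀ s : ℕ, ∃ M : ℕ, 1 ≤ M ∧ ∀ q L ℓ R : ℕ,
    ∀ (c : ℕ) (y : Fin (L + ℓ + R + 1) → (Fin (L + ℓ + R) → Bool) → Bool)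
      (lam : Fin (L + ℓ + R + 1) → Fin (L + ℓ + R) → ZMod p) (rr : Fin (L + ℓ + R + 1) → ZMod p),
      (∀ g u, y g u = decide ((∑ i, if u i then lam g i else 0) = rr g)) → GapSepBlock y L ℓ q →
      ∀ D : ℕ, JRankLE p y lam s D → 2 * M * (p * D + 2 * (ℓ / q) + 4) ≤ q → q ≤ ℓ →
      ((univ.filter fun u : Fin (L + ℓ + R) → Bool => ringWinU c y u = true).card : ℝ) ≤ 11 / 12 * (2 : ℝ) ^ (L + ℓ + R)

/-- **THE GAP LAW IS A THEOREM** for every prime `p ≠ 3` (`exists_budget_unit` + `win_le_of_gapSepBlock`). -/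
theorem blockGapLaw_holds (hp3 : p ≠ 3) : BlockGapLaw p := by
  intro s
  obtain ⟨M, hM1, hM⟩ := exists_budget_unit p s
  exact ⟨M, hM1, fun q L ℓ R c y lam rr hyl hG D hJR hbud hqℓ => win_le_of_gapSepBlock c y lam rr hp3 hyl hG hM hM1 hJR hbud hqℓ⟩

/-- **The gap law gives back the notch law**: `BlockGapLaw p → BlockJSpan p η` for every `η ≥ 1` (`θ = 11/12`, budget unit `8·η²·M`):
an `η`-separated block is `⌊ℓ/η⌋`-gap-separated, and `⌊ℓ/⌊ℓ/η⌋⌋ < 2η`. -/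
theorem blockJSpan_of_blockGapLaw {η : ℕ} (hη : 1 ≤ η) (h : BlockGapLaw p) : BlockJSpan p η := by
  intro s
  obtain ⟨M, hM1, hM⟩ := h s
  obtain ⟨k, rfl⟩ : ∃ k, η = k + 1 := ⟨η - 1, by omega⟩
  refine ⟨11 / 12, by norm_num, 8 * (k + 1) * (k + 1) * M, fun L ℓ R c y lam rr hyl hsep D hJR hℓ => ?_⟩
  have hG : GapSepBlock y L ℓ (ℓ / (k + 1)) := (sepBlock_iff_gapSepBlock y L ℓ (k + 1)).mp hsep
  have hqℓ : ℓ / (k + 1) ≤ ℓ := Nat.div_le_self ℓ (k + 1)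
  -- the unit: 2M(pD + 4η + 4)·η ≤ (pD + 2)·8η²M ≤ ℓ, hence 2M(pD + 4η + 4) ≤ q := ⌊ℓ/η⌋
  have key : 2 * M * (p * D + 4 * (k + 1) + 4) * (k + 1) ≤ (p * D + 2) * (8 * (k + 1) * (k + 1) * M) := by
    have e : (p * D + 2) * (8 * (k + 1) * (k + 1) * M) = 2 * M * (p * D + 4 * (k + 1) + 4) * (k + 1) +
        (8 * M * (p * D) * k ^ 2 + 14 * M * (p * D) * k + 6 * M * (p * D) + 8 * M * k ^ 2 + 8 * M * k) := by ring
    rw [e]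
    exact Nat.le_add_right _ _
  have h4 : 2 * M * (p * D + 4 * (k + 1) + 4) ≤ ℓ / (k + 1) := by
    rw [Nat.le_div_iff_mul_le (by omega)]
    exact le_trans key hℓ
  have hpos : 0 < 2 * M * (p * D + 4 * (k + 1) + 4) := Nat.mul_pos (by omega) (by omega)
  have hq0 : 0 < ℓ / (k + 1) := lt_of_lt_of_le hpos h4
  -- q ≥ 1 and ℓ < (q + 1)·η give ⌊ℓ/q⌋ < 2η
  have hdiv : ℓ / (ℓ / (k + 1)) < 2 * (k + 1) := by
    rw [Nat.div_lt_iff_lt_mul hq0]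
    have hlt : ℓ < ℓ / (k + 1) * (k + 1) + (k + 1) := Nat.lt_div_mul_add (by omega)
    have hle : k + 1 ≤ ℓ / (k + 1) * (k + 1) := Nat.le_mul_of_pos_left (k + 1) hq0
    calc ℓ < ℓ / (k + 1) * (k + 1) + (k + 1) := hlt
      _ ≤ ℓ / (k + 1) * (k + 1) + ℓ / (k + 1) * (k + 1) := Nat.add_le_add_left hle _
      _ = 2 * (k + 1) * (ℓ / (k + 1)) := by ring
  have hbud : 2 * M * (p * D + 2 * (ℓ / (ℓ / (k + 1))) + 4) ≤ ℓ / (k + 1) :=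
    le_trans (Nat.mul_le_mul_left _ (by omega)) h4
  exact hM (ℓ / (k + 1)) L ℓ R c y lam rr hyl hG D hJR hbud hqℓ

end BlockGapPiece

end Summit.QuantumAdvantage.QuantumAdvantage.Theorems.RankDial
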